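import Mathlib.RingTheory.MvPolynomial.Symmetric.Defs
import Mathlib.Tactic
import Literature.Geometry.Riemannian.TwoConvexSchoenfliesProofs
import Summits.CriticalPhenomena.PercolationContinuityZ3.Theorems.PercNearOneGluingNoHeavyLowerTailCPMonotone
import HarnessLib

/-!
# Site-model bookkeeping for THEOREM COV: weights, `Y`-set fibres, level families as
# elementary symmetric functions, and the conditional-Poisson swap comparison

Support file for the Sahi / Conjecture-P programme of route `PercNearOneGluingNoHeavy`
(`--supports stmt-CriticalPhenomena-4575`, prover prim-l12-p5 gen 31; proof note
`prim-l12-p5/MULTITYPE-PROOF-g31.md` §3–§4).  No definitions, no named facts, no sorries.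

SITE MODEL of THEOREM MT / THEOREM COV: sites `s ∈ S` with states `κ(s) ∈ {0,1,2}` (`0` empty,
`1` = `X`, `2` = `Y`), weights `1, P_s, Q_s`; configuration weight `w(κ) = ∏_s w_s(κ s)`.  This file
provides the finite-sum identities used by `…LowerTailSiteCovariance`:

* `weight_nonneg`, `weight_eq` : `w(κ) = Q^{κ⁻¹(2)} P^{κ⁻¹(1)} ≥ 0`;
* `fiber_sum` : summing over the configurations with a prescribed `Y`-set, `κ ↔ X₀ = κ⁻¹(1)`;
* `sum_powerset_card_eq_esymm`, `sum_powerset_card_mem_eq_esymm` : `Σ_{|X₀| = A} P^{X₀} = e_A`,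
  and the version with a marked element;
* `regroup` : regrouping a sum over configurations by the `Y`-set;
* `level_eq`, `levelX_eq` : the `Y`-site family `ν(Y₀) = [|Y₀| = C] Q^{Y₀} e_A(P | S ∖ Y₀)` and its
  `X`-marked version `[|Y₀| = C][s₁ ∉ Y₀] Q^{Y₀} P_{s₁} e_{A-1}(P | S ∖ Y₀ ∖ s₁)`;
* `map_insert_val`, `map_val_nonneg`, `esymm_swap` : the conditional-Poisson comparison
  `e_{A'}(x' ∷ M) e_{A'+1}(x ∷ v ∷ M) ≤ e_{A'}(x ∷ M) e_{A'+1}(x' ∷ v ∷ M)` for `x ≤ x'`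
  (from `CPMonotone.cp_inclusion_antitone`: the inclusion probability of the marked item `v` is
  antitone in the weight of a competitor).
-/

namespace Summit.CriticalPhenomena.PercolationContinuityZ3.Theorems

namespace SiteCovariance

open Finset Literature.Geometry.Riemannian

variable {S : Type*} [Fintype S] [DecidableEq S]

/-! ### Site weights -/

omit [DecidableEq S] in
/-- Site weights are non-negative. -/
theorem weight_nonneg (P Q : S → ℝ) (hP : ∀ s, 0 ≤ P s) (hQ : ∀ s, 0 ≤ Q s) (κ : S → Fin 3) :
    0 ≤ ∏ s, (if κ s = 1 then P s else if κ s = 2 then Q s else 1) :=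
  Finset.prod_nonneg fun s _ => by split_ifs; exacts [hP s, hQ s, zero_le_one]

omit [DecidableEq S] in
/-- The weight of a configuration factors over its `X`-set and its `Y`-set. -/
theorem weight_eq (P Q : S → ℝ) (κ : S → Fin 3) :
    (∏ s, (if κ s = 1 then P s else if κ s = 2 then Q s else 1)) =
      (∏ s ∈ univ.filter (fun s => κ s = 2), Q s) * ∏ s ∈ univ.filter (fun s => κ s = 1), P s := by
  rw [Finset.prod_filter, Finset.prod_filter, ← Finset.prod_mul_distrib]
  refine Finset.prod_congr rfl fun s _ => ?_
  obtain ⟨j, hj⟩ : ∃ j, κ s = j := ⟨_, rfl⟩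
  rw [hj]
  fin_cases j <;> simp

/-- **Summing over the configurations with a given `Y`-set** (`κ ↔ X₀ = κ⁻¹(1) ⊆ S ∖ Y₀`):
`Σ_{κ⁻¹(2) = Y₀} w(κ) φ(κ⁻¹(1)) = Q^{Y₀} · Σ_{X₀ ⊆ S ∖ Y₀} P^{X₀} φ(X₀)`. -/
theorem fiber_sum (P Q : S → ℝ) (Y₀ : Finset S) (φ : Finset S → ℝ) :
    ∑ κ ∈ univ.filter (fun κ : S → Fin 3 => univ.filter (fun s => κ s = 2) = Y₀),
        (∏ s, (if κ s = 1 then P s else if κ s = 2 then Q s else 1)) * φ (univ.filter (fun s => κ s = 1)) =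
      (∏ s ∈ Y₀, Q s) * ∑ X₀ ∈ (univ \ Y₀).powerset, (∏ s ∈ X₀, P s) * φ X₀ := by
  rw [Finset.mul_sum]
  refine Finset.sum_nbij' (fun κ => univ.filter (fun s => κ s = 1))
    (fun X₀ s => if s ∈ Y₀ then 2 else if s ∈ X₀ then 1 else 0) ?_ ?_ ?_ ?_ ?_
  · intro κ hκ
    have hY := (Finset.mem_filter.1 hκ).2
    rw [Finset.mem_powerset]
    intro s hs
    rw [Finset.mem_sdiff, ← hY]
    refine ⟨Finset.mem_univ s, fun h => ?_⟩
    have h1 := (Finset.mem_filter.1 hs).2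
    have h2 := (Finset.mem_filter.1 h).2
    rw [h1] at h2
    exact absurd h2 (by decide)
  · intro X₀ hX₀
    refine Finset.mem_filter.2 ⟨Finset.mem_univ _, ?_⟩
    ext s
    simp only [Finset.mem_filter, Finset.mem_univ, true_and]
    by_cases hs : s ∈ Y₀
    · simp [hs]
    · by_cases hx : s ∈ X₀ <;> simp [hs, hx]
  · intro κ hκ
    have hY := (Finset.mem_filter.1 hκ).2
    funext s
    by_cases h2 : κ s = 2
    · have : s ∈ Y₀ := by rw [← hY]; exact Finset.mem_filter.2 ⟨Finset.mem_univ _, h2⟩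
      rw [if_pos this, h2]
    · have : s ∉ Y₀ := by rw [← hY]; exact fun h => h2 (Finset.mem_filter.1 h).2
      rw [if_neg this]
      by_cases h1 : κ s = 1
      · rw [if_pos (show s ∈ univ.filter (fun s => κ s = 1) from
          Finset.mem_filter.2 ⟨Finset.mem_univ _, h1⟩), h1]
      · rw [if_neg (show s ∉ univ.filter (fun s => κ s = 1) from
          fun h => h1 (Finset.mem_filter.1 h).2)]
        obtain ⟨j, hj⟩ : ∃ j, κ s = j := ⟨_, rfl⟩
        rw [hj] at h1 h2 ⊢
        fin_cases j <;> simp_all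
  · intro X₀ hX₀
    have hsub := Finset.mem_powerset.1 hX₀
    ext s
    simp only [Finset.mem_filter, Finset.mem_univ, true_and]
    by_cases hs : s ∈ Y₀
    · simp only [hs, if_true]
      exact ⟨fun h => absurd h (by decide), fun h => absurd hs (Finset.mem_sdiff.1 (hsub h)).2⟩
    · by_cases hx : s ∈ X₀ <;> simp [hs, hx]
  · intro κ hκ
    have hY := (Finset.mem_filter.1 hκ).2
    rw [weight_eq, hY, mul_assoc]

omit [Fintype S] [DecidableEq S] in
/-- The part of a level family seen through `X`-sets of size `A`:
`Σ_{X₀ ⊆ G, |X₀| = A} P^{X₀} = e_A(P|_G)`. -/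
theorem sum_powerset_card_eq_esymm (P : S → ℝ) (G : Finset S) (A : ℕ) :
    ∑ X₀ ∈ G.powerset, (∏ s ∈ X₀, P s) * (if X₀.card = A then 1 else 0) = (G.val.map P).esymm A := by
  rw [Finset.esymm_map_val, Finset.powersetCard_eq_filter, Finset.sum_filter]
  refine Finset.sum_congr rfl fun X₀ _ => ?_
  split_ifs <;> simp

omit [Fintype S] in
/-- The same with the extra constraint `s₁ ∈ X₀` (for `s₁ ∈ G`):
`Σ_{X₀ ⊆ G, |X₀| = A+1, s₁ ∈ X₀} P^{X₀} = P_{s₁} · e_A(P|_{G ∖ s₁})`. -/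
theorem sum_powerset_card_mem_eq_esymm (P : S → ℝ) (G : Finset S) (s₁ : S) (hs₁ : s₁ ∈ G) (A : ℕ) :
    ∑ X₀ ∈ G.powerset, (∏ s ∈ X₀, P s) * (if X₀.card = A + 1 ∧ s₁ ∈ X₀ then 1 else 0) =
      P s₁ * ((G.erase s₁).val.map P).esymm A := by
  -- total = (sets avoiding s₁) + (sets containing s₁), and e_{A+1}(G) = e_{A+1}(G∖s₁) + P_{s₁} e_A(G∖s₁)
  have htot := sum_powerset_card_eq_esymm P G (A + 1)
  have hG : G = insert s₁ (G.erase s₁) := (Finset.insert_erase hs₁).symm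
  have hval : G.val.map P = P s₁ ::ₘ (G.erase s₁).val.map P := by
    conv_lhs => rw [hG]
    rw [Finset.insert_val_of_notMem (Finset.notMem_erase s₁ G), Multiset.map_cons]
  rw [hval, esymm_cons_succ] at htot
  -- the sets avoiding s₁
  have havoid : ∑ X₀ ∈ G.powerset, (∏ s ∈ X₀, P s) * (if X₀.card = A + 1 ∧ s₁ ∉ X₀ then 1 else 0) =
      ((G.erase s₁).val.map P).esymm (A + 1) := by
    rw [← sum_powerset_card_eq_esymm P (G.erase s₁) (A + 1)]
    rw [hG, Finset.powerset_insert, Finset.sum_union]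
    · rw [← hG]
      have h0 : ∑ X₀ ∈ (G.erase s₁).powerset.image (insert s₁),
          (∏ s ∈ X₀, P s) * (if X₀.card = A + 1 ∧ s₁ ∉ X₀ then (1:ℝ) else 0) = 0 := by
        refine Finset.sum_eq_zero fun X₀ hX₀ => ?_
        obtain ⟨T, _, rfl⟩ := Finset.mem_image.1 hX₀
        rw [if_neg (fun h => h.2 (Finset.mem_insert_self s₁ T)), mul_zero]
      rw [h0, add_zero]
      refine Finset.sum_congr rfl fun X₀ hX₀ => ?_
      have : s₁ ∉ X₀ := fun h => Finset.notMem_erase s₁ G (Finset.mem_powerset.1 hX₀ h)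
      simp [this]
    · exact Finset.disjoint_left.2 fun X₀ h1 h2 => by
        obtain ⟨T, _, rfl⟩ := Finset.mem_image.1 h2
        exact Finset.notMem_erase s₁ G (Finset.mem_powerset.1 h1 (Finset.mem_insert_self s₁ T))
  -- split the total
  have hsplit : ∑ X₀ ∈ G.powerset, (∏ s ∈ X₀, P s) * (if X₀.card = A + 1 then (1:ℝ) else 0) =
      ∑ X₀ ∈ G.powerset, (∏ s ∈ X₀, P s) * (if X₀.card = A + 1 ∧ s₁ ∈ X₀ then 1 else 0) +
      ∑ X₀ ∈ G.powerset, (∏ s ∈ X₀, P s) * (if X₀.card = A + 1 ∧ s₁ ∉ X₀ then 1 else 0) := by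
    rw [← Finset.sum_add_distrib]
    refine Finset.sum_congr rfl fun X₀ _ => ?_
    by_cases h : X₀.card = A + 1 <;> by_cases h' : s₁ ∈ X₀ <;> simp [h, h']
  rw [hsplit, havoid] at htot
  linarith

/-- Regrouping a sum over configurations by their `Y`-set. -/
theorem regroup (p : (S → Fin 3) → Prop) [DecidablePred p] (T : Finset (Finset S))
    (f : (S → Fin 3) → ℝ) :
    ∑ Y₀ ∈ T, ∑ κ ∈ univ.filter (fun κ : S → Fin 3 => univ.filter (fun s => κ s = 2) = Y₀ ∧ p κ), f κ =
      ∑ κ ∈ univ.filter (fun κ : S → Fin 3 => p κ ∧ univ.filter (fun s => κ s = 2) ∈ T), f κ := by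
  rw [← Finset.sum_fiberwise_of_maps_to (s := univ.filter (fun κ : S → Fin 3 =>
      p κ ∧ univ.filter (fun s => κ s = 2) ∈ T)) (t := T)
      (g := fun κ => univ.filter (fun s => κ s = 2)) (fun κ hκ => ((Finset.mem_filter.1 hκ).2).2)]
  refine Finset.sum_congr rfl fun Y₀ hY₀ => Finset.sum_congr ?_ fun _ _ => rfl
  ext κ
  simp only [Finset.mem_filter, Finset.mem_univ, true_and]
  constructor
  · rintro ⟨h1, h2⟩; exact ⟨⟨h2, h1 ▸ hY₀⟩, h1⟩
  · rintro ⟨⟨h2, _⟩, h1⟩; exact ⟨h1, h2⟩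

/-! ### The level family and its `X`-marked version as elementary symmetric functions -/

/-- **The `Y`-site family in closed form**: `ν(Y₀) = [|Y₀| = C] · Q^{Y₀} · e_A(P | S ∖ Y₀)`. -/
theorem level_eq (P Q : S → ℝ) (A C : ℕ) (Y₀ : Finset S) :
    ∑ κ ∈ univ.filter (fun κ : S → Fin 3 =>
        univ.filter (fun s => κ s = 2) = Y₀ ∧ (univ.filter (fun s => κ s = 1)).card = A ∧
          (univ.filter (fun s => κ s = 2)).card = C),
        (∏ s, (if κ s = 1 then P s else if κ s = 2 then Q s else 1)) =
      (if Y₀.card = C then 1 else 0) * (∏ s ∈ Y₀, Q s) * ((univ \ Y₀).val.map P).esymm A := by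
  have h1 : ∑ κ ∈ univ.filter (fun κ : S → Fin 3 =>
        univ.filter (fun s => κ s = 2) = Y₀ ∧ (univ.filter (fun s => κ s = 1)).card = A ∧
          (univ.filter (fun s => κ s = 2)).card = C),
        (∏ s, (if κ s = 1 then P s else if κ s = 2 then Q s else 1)) =
      ∑ κ ∈ univ.filter (fun κ : S → Fin 3 => univ.filter (fun s => κ s = 2) = Y₀),
        (∏ s, (if κ s = 1 then P s else if κ s = 2 then Q s else 1)) *
          (if (univ.filter (fun s => κ s = 1)).card = A ∧ Y₀.card = C then 1 else 0) := by
    rw [Finset.sum_filter, Finset.sum_filter]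
    refine Finset.sum_congr rfl fun κ _ => ?_
    by_cases hY : univ.filter (fun s => κ s = 2) = Y₀
    · rw [← hY]
      by_cases h : (univ.filter (fun s => κ s = 1)).card = A ∧ (univ.filter (fun s => κ s = 2)).card = C
      · rw [if_pos ⟨rfl, h⟩, if_pos rfl, if_pos h, mul_one]
      · rw [if_neg (fun h' => h h'.2), if_pos rfl, if_neg h, mul_zero]
    · rw [if_neg (fun h' => hY h'.1), if_neg hY]
  rw [h1, fiber_sum P Q Y₀ (fun X₀ => if X₀.card = A ∧ Y₀.card = C then 1 else 0)]
  by_cases hC : Y₀.card = C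
  · simp only [hC, and_true, if_true, one_mul]
    rw [sum_powerset_card_eq_esymm]
  · simp [hC]

/-- **The `X`-marked family in closed form**: for `A = A' + 1`,
`Σ {w(κ) : κ⁻¹(2) = Y₀, quotas, κ(s₁) = 1} = [|Y₀| = C][s₁ ∉ Y₀] · Q^{Y₀} · P_{s₁} · e_{A'}(P | S ∖ Y₀ ∖ s₁)`. -/
theorem levelX_eq (P Q : S → ℝ) (A' C : ℕ) (s₁ : S) (Y₀ : Finset S) :
    ∑ κ ∈ univ.filter (fun κ : S → Fin 3 =>
        univ.filter (fun s => κ s = 2) = Y₀ ∧ (((univ.filter (fun s => κ s = 1)).card = A' + 1 ∧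
          (univ.filter (fun s => κ s = 2)).card = C) ∧ κ s₁ = 1)),
        (∏ s, (if κ s = 1 then P s else if κ s = 2 then Q s else 1)) =
      (if Y₀.card = C ∧ s₁ ∉ Y₀ then 1 else 0) * (∏ s ∈ Y₀, Q s) *
        (P s₁ * (((univ \ Y₀).erase s₁).val.map P).esymm A') := by
  have h1 : ∑ κ ∈ univ.filter (fun κ : S → Fin 3 =>
        univ.filter (fun s => κ s = 2) = Y₀ ∧ (((univ.filter (fun s => κ s = 1)).card = A' + 1 ∧
          (univ.filter (fun s => κ s = 2)).card = C) ∧ κ s₁ = 1)),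
        (∏ s, (if κ s = 1 then P s else if κ s = 2 then Q s else 1)) =
      ∑ κ ∈ univ.filter (fun κ : S → Fin 3 => univ.filter (fun s => κ s = 2) = Y₀),
        (∏ s, (if κ s = 1 then P s else if κ s = 2 then Q s else 1)) *
          (if ((univ.filter (fun s => κ s = 1)).card = A' + 1 ∧ s₁ ∈ univ.filter (fun s => κ s = 1)) ∧
            Y₀.card = C then 1 else 0) := by
    rw [Finset.sum_filter, Finset.sum_filter]
    refine Finset.sum_congr rfl fun κ _ => ?_
    have hs₁ : s₁ ∈ univ.filter (fun s => κ s = 1) ↔ κ s₁ = 1 := by simp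
    by_cases hY : univ.filter (fun s => κ s = 2) = Y₀
    · rw [← hY]
      by_cases h : (((univ.filter (fun s => κ s = 1)).card = A' + 1 ∧
          (univ.filter (fun s => κ s = 2)).card = C) ∧ κ s₁ = 1)
      · rw [if_pos ⟨rfl, h⟩, if_pos rfl, if_pos ⟨⟨h.1.1, hs₁.2 h.2⟩, h.1.2⟩, mul_one]
      · rw [if_neg (fun h' => h h'.2), if_pos rfl, if_neg (fun h' => h ⟨⟨h'.1.1, h'.2⟩, hs₁.1 h'.1.2⟩),
          mul_zero]
    · rw [if_neg (fun h' => hY h'.1), if_neg hY]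
  rw [h1, fiber_sum P Q Y₀ (fun X₀ => if (X₀.card = A' + 1 ∧ s₁ ∈ X₀) ∧ Y₀.card = C then 1 else 0)]
  by_cases hC : Y₀.card = C
  · simp only [hC, and_true, true_and]
    by_cases hs : s₁ ∈ Y₀
    · -- no admissible X-set contains s₁
      simp only [hs, not_true_eq_false, if_false, zero_mul]
      refine (mul_eq_zero.2 (Or.inr (Finset.sum_eq_zero fun X₀ hX₀ => ?_))).trans (by ring)
      rw [if_neg (fun h => (Finset.mem_sdiff.1 (Finset.mem_powerset.1 hX₀ h.2)).2 hs), mul_zero]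
    · simp only [hs, not_false_eq_true, if_true, one_mul]
      rw [sum_powerset_card_mem_eq_esymm P (univ \ Y₀) s₁ (Finset.mem_sdiff.2 ⟨Finset.mem_univ _, hs⟩)]
  · simp [hC]


/-! ### Swap monotonicity -/

omit [Fintype S] in
/-- Multiset of weights of `insert x T`. -/
theorem map_insert_val (P : S → ℝ) {x : S} {T : Finset S} (hx : x ∉ T) :
    (insert x T).val.map P = P x ::ₘ T.val.map P := by
  rw [Finset.insert_val_of_notMem hx, Multiset.map_cons]

omit [Fintype S] [DecidableEq S] in
/-- Weights are non-negative on any multiset of sites. -/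
theorem map_val_nonneg (P : S → ℝ) (hP : ∀ s, 0 ≤ P s) (T : Finset S) :
    ∀ x ∈ T.val.map P, 0 ≤ x := by
  intro x hx
  obtain ⟨s, _, rfl⟩ := Multiset.mem_map.1 hx
  exact hP s

/-- **The conditional-Poisson comparison behind the swap** (CPMonotone): for a multiset `M ≥ 0`,
weights `x ≤ x'` of the exchanged competitor and `v` of the marked item,
`e_{A'}(x' ∷ M) · e_{A'+1}(x ∷ v ∷ M) ≤ e_{A'}(x ∷ M) · e_{A'+1}(x' ∷ v ∷ M)`. -/
theorem esymm_swap (M : Multiset ℝ) (hM : ∀ y ∈ M, 0 ≤ y) (A' : ℕ) (x x' v : ℝ) (hxx' : x ≤ x') :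
    (x' ::ₘ M).esymm A' * (x ::ₘ v ::ₘ M).esymm (A' + 1) ≤
      (x ::ₘ M).esymm A' * (x' ::ₘ v ::ₘ M).esymm (A' + 1) := by
  cases A' with
  | zero =>
    rw [esymm_zero_eq_one, esymm_zero_eq_one, esymm_cons_succ, esymm_cons_succ, esymm_cons_succ,
      esymm_cons_succ, esymm_zero_eq_one, esymm_zero_eq_one]
    nlinarith
  | succ k =>
    rw [esymm_cons_succ, esymm_cons_succ, esymm_cons_succ, esymm_cons_succ, esymm_cons_succ,
      esymm_cons_succ, esymm_cons_succ, esymm_cons_succ]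
    have h := CPMonotone.cp_inclusion_antitone M hM k x x' v hxx'
    have NN := esymm_nonneg_of_forall_nonneg M hM
    nlinarith [h, NN k, NN (k+1), NN (k+2)]

end SiteCovariance

end Summit.CriticalPhenomena.PercolationContinuityZ3.Theorems
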